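import Summits.KontsevichZagierPeriods.KontsevichZagierPeriods.Theorems.TerasomaMultiplicationMultiplicationAccessibleDoubling
import Summits.KontsevichZagierPeriods.KontsevichZagierPeriods.Theorems.BetaCancellation.Negative.KernelForm

/-!
# `MultiplicationAccessible` (stmt-KontsevichZagierPeriods-12305), line `shifted-family-prime-sieve`:
the residual modulo `BetaCancellation` — the shifted family IS the crux at the odd primes

The line reduces the crux (Gauss multiplication inside the Kontsevich–Zagier rules at every `n`) to
the SHIFTED family `GM(p−1; x, s)` at the odd primes `p` (Sieve); its two open stubs are `GM` at
`p = 3` (`x` free) and at `p ≥ 5`. This file shows, sorry-free, that **modulo the route's crux 4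
`BetaCancellation`** the shifted residual is exactly the UNSHIFTED crux at the odd primes:

* `gm_of_betaCancellation_of_at` — `BetaCancellation → (∀ z > 0, At m z) → GM(m; x, s) ∀ x, s > 0`;
* `multiplicationAccessible_of_betaCancellation_of_primes` — `BetaCancellation` and the crux
  instances at `m = p − 1`, `p ≥ 5` prime, give `MultiplicationAccessible` (the `p = 3` instances are
  the landed `MultiplicationThree`);
* (`…CancellationReductionSmooth.lean`) `BetaCancellation` alone gives the crux at every `n = 2^a·3^b`
  (unconditionally known so far: `n = 2^k`, Sieve; `n = 3·2^k`, Doubling).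

The computation is in the formal period ring `P = KZ.FormalPeriodRing` (Beta classes
`g(p,q) = ⟦β(p,q)⟧` of a pinned family, API `MultGlue.*`, `Doubling.*`). With `n = m + 1`,
`L_C(z) = ∏_(k=1)^m g(k/n, z)` (box side of the instance `At m z`), `D(z) = ∏_(j<m) g(z, (j+1)z)`
(Dirichlet block; `At m z ⟺ L_C(z) = ⟦n^(nz−1)⟧ D(z)`, `Doubling.at_iff_prod_range_eq`),
`A = ∏_(k=1)^m g(x + k/n, s)`:
1. `A · L_C(x) = g(x,s)^m · L_C(x+s)` — `m` re-associations `g(k,x)g(k+x,s) = g(x,s)g(k,x+s)`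
   (`Cancellation.chain_eq`);
2. `g(nx,ns) · D(x) · D(s) = g(x,s)^n · D(x+s)` — two bracketings of the Dirichlet integral
   `Γ(x)^nΓ(s)^n/Γ(n(x+s))`, `m` rotation steps of three re-associations and two reflections each
   (`Cancellation.bracket_eq`, `Cancellation.rotate_eq`);
3. hence `D(x) · (⟦n^(nx−1)⟧ g(x,s) A) = D(x) · (⟦n^(n(x+s)−1)⟧ g(nx,ns) ∏ g((j+1)s, s))`, both sides
   classes of single Beta boxes; `BetaCancellation` cancels `D(x)` factor by factor
   (`Cancellation.cancel_prod_eq`, via `BetaCancellationNegative.betaCancellation_iff` /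
   `isPinned_prod`), and the rational-power constant `n^(nx−1)` is a unit of `P`.
(`GM(x,s) = C(x+s) − C(x)` in Γ-symbols: the coefficient of `L_C(x)` is negative, so a cancellation
is unavoidable on this road.) References: Kontsevich–Zagier 2001 §1.2; Andrews–Askey–Roy 1999,
Thm 1.5.2 (Gauss), Thm 1.8.1 (Dirichlet).
-/

noncomputable section

open MeasureTheory Set Finset
open scoped BigOperators
open Literature.NumberTheory.Transcendental
open Literature.NumberTheory.Transcendental.KZ
open Summit.KontsevichZagierPeriods.MultiplicationAccessible.Negative (boxDom At multiplicationAccessible_iff)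

namespace Summit.KontsevichZagierPeriods.TerasomaMultiplication.MultiplicationAccessible

namespace Cancellation

open Summit.KontsevichZagierPeriods.KontsevichZagierPeriods.Theses.TerasomaMultiplication (BetaCancellation)
open Summit.KontsevichZagierPeriods.KontsevichZagierPeriods.BetaCancellationNegative
  (betaKernel betaCancellation_iff isPinned_prod)

/-- **`BetaCancellation` in `P`**: `g(a,b) · ⟦r⟧ = g(a,b) · ⟦r'⟧ → ⟦r⟧ = ⟦r'⟧` for single representations
`r, r'` (`⟦β⟧⟦r⟧ = ⟦β × r⟧`, and `β(a,b) × r` is pinned over `r` with the Beta kernel). [folklore] -/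
theorem cancel_eq (hBC : BetaCancellation) {B : ℚ → ℚ → IntegralRep 1}
    (hB : ∀ p q, 0 < p → 0 < q → (B p q).domain = {t | t 0 ∈ Set.Ioo (0:ℝ) 1} ∧
      (B p q).integrand = fun t => (t 0) ^ ((p:ℝ) - 1) * (1 - t 0) ^ ((q:ℝ) - 1))
    {a b : ℚ} (ha : 0 < a) (hb : 0 < b) {n n' : ℕ} (r : IntegralRep n) (r' : IntegralRep n')
    (h : toFormalPeriod (of (B a b)) * toFormalPeriod (of r) =
      toFormalPeriod (of (B a b)) * toFormalPeriod (of r')) :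
    toFormalPeriod (of r) = toFormalPeriod (of r') := by
  rw [toFormalPeriod_of_mul_of, toFormalPeriod_of_mul_of] at h
  have hdom : (B a b).domain = KZreg.unitIoo := (hB a b ha hb).1
  have hk : ∀ x ∈ KZreg.unitIoo, (B a b).integrand x = betaKernel a b (x 0) := fun x _ => by
    rw [(hB a b ha hb).2]; rfl
  exact (betaCancellation_iff.mp hBC a b ha hb r r' _ _ (isPinned_prod (B a b) hdom hk r)
    (isPinned_prod (B a b) hdom hk r') (toFormalPeriod_eq_iff.mp h)).toFormalPeriod_eq

/-- Cancellation of a product of Beta classes (factor by factor, innermost first). [folklore] -/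
theorem cancel_prod_eq (hBC : BetaCancellation) {B : ℚ → ℚ → IntegralRep 1}
    (hB : ∀ p q, 0 < p → 0 < q → (B p q).domain = {t | t 0 ∈ Set.Ioo (0:ℝ) 1} ∧
      (B p q).integrand = fun t => (t 0) ^ ((p:ℝ) - 1) * (1 - t 0) ^ ((q:ℝ) - 1))
    (a b : ℕ → ℚ) : ∀ (m : ℕ), (∀ j < m, 0 < a j) → (∀ j < m, 0 < b j) →
    ∀ {n n' : ℕ} (r : IntegralRep n) (r' : IntegralRep n'),
    (∏ j ∈ range m, toFormalPeriod (of (B (a j) (b j)))) * toFormalPeriod (of r) =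
      (∏ j ∈ range m, toFormalPeriod (of (B (a j) (b j)))) * toFormalPeriod (of r') →
    toFormalPeriod (of r) = toFormalPeriod (of r')
  | 0, _, _, n, n', r, r', h => by simpa using h
  | m + 1, ha, hb, n, n', r, r', h => by
    rw [prod_range_succ, mul_assoc, mul_assoc, toFormalPeriod_of_mul_of, toFormalPeriod_of_mul_of]
      at h
    have h' := cancel_prod_eq hBC hB a b m (fun j hj => ha j (by omega)) (fun j hj => hb j (by omega))
      _ _ h
    rw [← toFormalPeriod_of_mul_of, ← toFormalPeriod_of_mul_of] at h'
    exact cancel_eq hBC hB (ha m (by omega)) (hb m (by omega)) r r' h'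

/-- **The re-association chain**: `(∏_(i<m) g(x + (i+1)/(m+1), s)) · ∏_(i<m) g((i+1)/(m+1), x)
= g(x,s)^m · ∏_(i<m) g((i+1)/(m+1), x+s)` — factorwise `g(k,x)g(k+x,s) = g(x,s)g(k,x+s)`
(`MultGlue.reassoc_eq`). Value identity: `∏ B(x+k,s)B(k,x) = B(x,s)^m ∏ B(k,x+s)`. [folklore] -/
theorem chain_eq {B : ℚ → ℚ → IntegralRep 1}
    (hB : ∀ p q, 0 < p → 0 < q → (B p q).domain = {t | t 0 ∈ Set.Ioo (0:ℝ) 1} ∧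
      (B p q).integrand = fun t => (t 0) ^ ((p:ℝ) - 1) * (1 - t 0) ^ ((q:ℝ) - 1))
    (m : ℕ) {x s : ℚ} (hx : 0 < x) (hs : 0 < s) :
    (∏ i ∈ range m, toFormalPeriod (of (B (x + ((i:ℚ) + 1) / ((m:ℚ) + 1)) s))) *
        ∏ i ∈ range m, toFormalPeriod (of (B (((i:ℚ) + 1) / ((m:ℚ) + 1)) x)) =
      toFormalPeriod (of (B x s)) ^ m *
        ∏ i ∈ range m, toFormalPeriod (of (B (((i:ℚ) + 1) / ((m:ℚ) + 1)) (x + s))) := by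
  rw [← prod_mul_distrib, ← card_range m, ← prod_const, card_range, ← prod_mul_distrib]
  refine prod_congr rfl fun i _ => ?_
  have hk : (0:ℚ) < ((i:ℚ) + 1) / ((m:ℚ) + 1) := by positivity
  have key := MultGlue.reassoc_eq hB stub_betaReassoc hk hx hs
  rw [show ((i:ℚ) + 1) / ((m:ℚ) + 1) + x = x + ((i:ℚ) + 1) / ((m:ℚ) + 1) by ring] at key
  linear_combination key

/-- The rotation step `g((k+1)x,(k+1)s) g(x,kx) g(s,ks) = g(x,s) g(x+s,k(x+s)) g(kx,ks)`: two bracketings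
of `Γ(x)Γ(kx)Γ(s)Γ(ks)/Γ((k+1)(x+s))`, 3 re-associations + 2 reflections. [cite: AndrewsAskeyRoy1999, Thm 1.8.1] -/
theorem rotate_eq {B : ℚ → ℚ → IntegralRep 1}
    (hB : ∀ p q, 0 < p → 0 < q → (B p q).domain = {t | t 0 ∈ Set.Ioo (0:ℝ) 1} ∧
      (B p q).integrand = fun t => (t 0) ^ ((p:ℝ) - 1) * (1 - t 0) ^ ((q:ℝ) - 1))
    {k x s : ℚ} (hk : 0 < k) (hx : 0 < x) (hs : 0 < s) :
    toFormalPeriod (of (B ((k + 1) * x) ((k + 1) * s))) * toFormalPeriod (of (B x (k * x))) *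
        toFormalPeriod (of (B s (k * s))) =
      toFormalPeriod (of (B x s)) * toFormalPeriod (of (B (x + s) (k * (x + s)))) *
        toFormalPeriod (of (B (k * x) (k * s))) := by
  have hkx : 0 < k * x := mul_pos hk hx; have hks : 0 < k * s := mul_pos hk hs
  have k1 := MultGlue.reassoc_eq hB stub_betaReassoc (p := x) (q := k * x) (r := s + k * s) hx hkx
    (by positivity)
  have k2 := MultGlue.reassoc_eq hB stub_betaReassoc (p := s) (q := k * s) (r := k * x) hs hks hkx
  have k3 := MultGlue.reassoc_eq hB stub_betaReassoc (p := x) (q := s) (r := k * s + k * x) hx hs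
    (by positivity)
  have r1 := Doubling.refl_eq hB (p := k * x) (q := s + k * s) hkx (by positivity)
  have r2 := Doubling.refl_eq hB (p := k * s) (q := k * x) hks hkx
  rw [show k * x + (s + k * s) = s + (k * s + k * x) by ring] at k1
  rw [show (k + 1) * x = x + k * x by ring, show (k + 1) * s = s + k * s by ring,
    show k * (x + s) = k * s + k * x by ring]
  linear_combination toFormalPeriod (of (B s (k * s))) * k1 +
    (toFormalPeriod (of (B x (s + (k * s + k * x)))) * toFormalPeriod (of (B s (k * s)))) * r1 +
    toFormalPeriod (of (B x (s + (k * s + k * x)))) * k2 -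
    toFormalPeriod (of (B (k * s) (k * x))) * k3 +
    (toFormalPeriod (of (B x s)) * toFormalPeriod (of (B (x + s) (k * s + k * x)))) * r2

/-- **The bracketing**: `g((m+1)x,(m+1)s) · ∏_(j<m) g(x,(j+1)x) · ∏_(j<m) g(s,(j+1)s)
= g(x,s)^(m+1) · ∏_(j<m) g(x+s,(j+1)(x+s))` — both sides are bracketings of the Dirichlet integral
`Γ(x)^(m+1)Γ(s)^(m+1)/Γ((m+1)(x+s))` into Beta classes; `m` rotation steps (`rotate_eq`).
[cite: AndrewsAskeyRoy1999, Thm 1.8.1] -/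
theorem bracket_eq {B : ℚ → ℚ → IntegralRep 1}
    (hB : ∀ p q, 0 < p → 0 < q → (B p q).domain = {t | t 0 ∈ Set.Ioo (0:ℝ) 1} ∧
      (B p q).integrand = fun t => (t 0) ^ ((p:ℝ) - 1) * (1 - t 0) ^ ((q:ℝ) - 1))
    {x s : ℚ} (hx : 0 < x) (hs : 0 < s) : ∀ m : ℕ,
    toFormalPeriod (of (B (((m:ℚ) + 1) * x) (((m:ℚ) + 1) * s))) *
        (∏ j ∈ range m, toFormalPeriod (of (B x (((j:ℚ) + 1) * x)))) *
        (∏ j ∈ range m, toFormalPeriod (of (B s (((j:ℚ) + 1) * s)))) =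
      toFormalPeriod (of (B x s)) ^ (m + 1) *
        ∏ j ∈ range m, toFormalPeriod (of (B (x + s) (((j:ℚ) + 1) * (x + s))))
  | 0 => by
    rw [prod_range_zero, prod_range_zero, prod_range_zero, Nat.cast_zero, zero_add, one_mul,
      one_mul, mul_one, mul_one, mul_one, zero_add, pow_one]
  | m + 1 => by
    have ih := bracket_eq hB hx hs m
    have hk : (0:ℚ) < (m:ℚ) + 1 := by positivity
    have step := rotate_eq hB hk hx hs
    rw [prod_range_succ, prod_range_succ, prod_range_succ, pow_succ]
    push_cast
    linear_combination ((∏ j ∈ range m, toFormalPeriod (of (B x (((j:ℚ) + 1) * x)))) *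
      (∏ j ∈ range m, toFormalPeriod (of (B s (((j:ℚ) + 1) * s))))) * step +
      (toFormalPeriod (of (B x s)) * toFormalPeriod (of (B (x + s) (((m:ℚ) + 1) * (x + s))))) * ih

/-- Reflection on a Dirichlet block: `∏_(j<m) g((j+1)s, s) = ∏_(j<m) g(s, (j+1)s)`. [folklore] -/
theorem prod_refl_eq {B : ℚ → ℚ → IntegralRep 1}
    (hB : ∀ p q, 0 < p → 0 < q → (B p q).domain = {t | t 0 ∈ Set.Ioo (0:ℝ) 1} ∧
      (B p q).integrand = fun t => (t 0) ^ ((p:ℝ) - 1) * (1 - t 0) ^ ((q:ℝ) - 1))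
    (m : ℕ) {s : ℚ} (hs : 0 < s) :
    ∏ j ∈ range m, toFormalPeriod (of (B (((j:ℚ) + 1) * s) s)) =
      ∏ j ∈ range m, toFormalPeriod (of (B s (((j:ℚ) + 1) * s))) :=
  prod_congr rfl fun j _ => Doubling.refl_eq hB (by positivity) hs

/-- The constant book-keeping: `(n^(nx−1))⁻¹ · n^(n(x+s)−1) = n^(ns)`, `n = m + 1`. [folklore] -/
theorem cancelConst_eq (m : ℕ) (x s : ℚ) :
    ((((m:ℝ) + 1) ^ (((m:ℝ) + 1) * x - 1))⁻¹ * (((m:ℝ) + 1) ^ (((m:ℝ) + 1) * (((x + s : ℚ)) : ℝ) - 1))) =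
      ((m:ℝ) + 1) ^ (((m:ℝ) + 1) * (s:ℝ)) := by
  have hn : (0:ℝ) < (m:ℝ) + 1 := by positivity
  rw [inv_mul_eq_div, ← Real.rpow_sub hn]
  congr 1
  push_cast
  ring

/-- **The shifted family times a Dirichlet block, from two crux instances (unconditional), in `P`.**
If `At m x` and `At m (x+s)` hold (`n = m + 1`), then
`D(x) · ⟦[pt,1]⟧ ∏_(k<n) g(x + k/n, s) = D(x) · ⟦[pt, n^(ns)]⟧ g(nx, ns) ∏_(1≤k<n) g(ks, s)` with the
Dirichlet block `D(x) = ∏_(j<m) g(x, (j+1)x)`: the shifted Gauss multiplication `GM(m; x, s)` in `P`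
MULTIPLIED BY `D(x)`. Chain: `g(x,s)·A·L_C(x) = g(x,s)^n L_C(x+s)` (`chain_eq`), the instances
`L_C(z) = ⟦n^(nz−1)⟧ D(z)` at `z = x, x+s`, the bracketing `g(nx,ns) D(x) D(s) = g(x,s)^n D(x+s)`
(`bracket_eq`), and division by the rational-power constant `n^(nx−1)` (a unit of `P`).
[cite: AndrewsAskeyRoy1999, Thm 1.5.2] -/
theorem dirichletBlock_mul_gm_prod_eq {B : ℚ → ℚ → IntegralRep 1}
    (hB : ∀ p q, 0 < p → 0 < q → (B p q).domain = {t | t 0 ∈ Set.Ioo (0:ℝ) 1} ∧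
      (B p q).integrand = fun t => (t 0) ^ ((p:ℝ) - 1) * (1 - t 0) ^ ((q:ℝ) - 1))
    (m : ℕ) {x s : ℚ} (hx : 0 < x) (hs : 0 < s) (hAx : At m x) (hAxs : At m (x + s)) :
    (∏ j ∈ range m, toFormalPeriod (of (B x (((j:ℚ) + 1) * x)))) *
        (toFormalPeriod (of (IntegralRep.unit.constMul (1:ℝ) isAlgebraic_one)) *
          ∏ k : Fin (m + 1), toFormalPeriod (of (B (x + (k : ℚ) / ((m : ℚ) + 1)) s))) =
      (∏ j ∈ range m, toFormalPeriod (of (B x (((j:ℚ) + 1) * x)))) *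
        (toFormalPeriod (of (IntegralRep.unit.constMul (((m:ℝ) + 1) ^ (((m:ℝ) + 1) * (s:ℝ)))
          (MultGlue.isAlgebraic_gaussConst m s))) *
          ∏ k : Fin (m + 1), toFormalPeriod (of (B
            (if (k : ℕ) = 0 then ((m : ℚ) + 1) * x else (k : ℚ) * s)
            (if (k : ℕ) = 0 then ((m : ℚ) + 1) * s else s)))) := by
  have hxs : 0 < x + s := by positivity
  -- the two crux instances, the chain, the bracketing, the reflection
  have hcx := (Doubling.at_iff_prod_range_eq hB m x hx).mp hAx
  have hcxs := (Doubling.at_iff_prod_range_eq hB m (x + s) hxs).mp hAxs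
  have chain := chain_eq hB m hx hs
  have brk := bracket_eq hB hx hs m
  have reflD := prod_refl_eq hB m hs
  -- range forms of the two Fin-indexed products
  have hL : ∏ k : Fin (m + 1), toFormalPeriod (of (B (x + (k : ℚ) / ((m : ℚ) + 1)) s)) =
      (∏ i ∈ range m, toFormalPeriod (of (B (x + ((i:ℚ) + 1) / ((m:ℚ) + 1)) s))) *
        toFormalPeriod (of (B x s)) := by
    rw [Fin.prod_univ_eq_prod_range (fun k => toFormalPeriod (of (B (x + (k : ℚ) / ((m : ℚ) + 1)) s)))
      (m + 1), prod_range_succ']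
    simp only [Nat.cast_succ, Nat.cast_zero, zero_div, add_zero]
  have hR : ∏ k : Fin (m + 1), toFormalPeriod (of (B
        (if (k : ℕ) = 0 then ((m : ℚ) + 1) * x else (k : ℚ) * s)
        (if (k : ℕ) = 0 then ((m : ℚ) + 1) * s else s))) =
      toFormalPeriod (of (B (((m:ℚ) + 1) * x) (((m:ℚ) + 1) * s))) *
        ∏ j ∈ range m, toFormalPeriod (of (B (((j:ℚ) + 1) * s) s)) := by
    rw [Fin.prod_univ_succ, ← Fin.prod_univ_eq_prod_range (fun j => toFormalPeriod (of
      (B (((j:ℚ) + 1) * s) s))) m]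
    simp [Fin.val_succ]
  -- both sides agree after multiplication by `D(x)`, up to the constants `n^(nz−1)`
  have key : (∏ j ∈ range m, toFormalPeriod (of (B x (((j:ℚ) + 1) * x)))) *
      (toFormalPeriod (of (IntegralRep.unit.constMul _ (isAlgebraic_gaussMultConst m x))) *
        ∏ k : Fin (m + 1), toFormalPeriod (of (B (x + (k : ℚ) / ((m : ℚ) + 1)) s))) =
      (∏ j ∈ range m, toFormalPeriod (of (B x (((j:ℚ) + 1) * x)))) *
      (toFormalPeriod (of (IntegralRep.unit.constMul _ (isAlgebraic_gaussMultConst m (x + s)))) *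
        ∏ k : Fin (m + 1), toFormalPeriod (of (B
          (if (k : ℕ) = 0 then ((m : ℚ) + 1) * x else (k : ℚ) * s)
          (if (k : ℕ) = 0 then ((m : ℚ) + 1) * s else s)))) := by
    rw [hL, hR]
    linear_combination
      (-(toFormalPeriod (of (B x s)) *
          ∏ i ∈ range m, toFormalPeriod (of (B (x + ((i:ℚ) + 1) / ((m:ℚ) + 1)) s)))) * hcx
      + toFormalPeriod (of (B x s)) * chain
      + toFormalPeriod (of (B x s)) ^ (m + 1) * hcxs
      - toFormalPeriod (of (IntegralRep.unit.constMul _ (isAlgebraic_gaussMultConst m (x + s)))) * brk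
      - (toFormalPeriod (of (IntegralRep.unit.constMul _ (isAlgebraic_gaussMultConst m (x + s)))) *
          toFormalPeriod (of (B (((m:ℚ) + 1) * x) (((m:ℚ) + 1) * s))) *
          ∏ j ∈ range m, toFormalPeriod (of (B x (((j:ℚ) + 1) * x)))) * reflD
  -- divide by the (invertible, rational-power) constant `n^(nx−1)`
  have hinv : IsAlgebraic ℚ ((((m:ℝ) + 1) ^ (((m:ℝ) + 1) * x - 1))⁻¹) :=
    (isAlgebraic_gaussMultConst m x).inv
  have e1 : toFormalPeriod (of (IntegralRep.unit.constMul _ hinv)) *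
      toFormalPeriod (of (IntegralRep.unit.constMul _ (isAlgebraic_gaussMultConst m x))) =
      toFormalPeriod (of (IntegralRep.unit.constMul (1:ℝ) isAlgebraic_one)) := by
    rw [← MultGlue.ptConst_mul hinv (isAlgebraic_gaussMultConst m x)
      (hinv.mul (isAlgebraic_gaussMultConst m x))]
    exact MultGlue.ptConst_congr _ _ (inv_mul_cancel₀ (gaussMultConst_pos m x).ne')
  have e2 : toFormalPeriod (of (IntegralRep.unit.constMul _ hinv)) *
      toFormalPeriod (of (IntegralRep.unit.constMul _ (isAlgebraic_gaussMultConst m (x + s)))) =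
      toFormalPeriod (of (IntegralRep.unit.constMul (((m:ℝ) + 1) ^ (((m:ℝ) + 1) * (s:ℝ)))
        (MultGlue.isAlgebraic_gaussConst m s))) := by
    rw [← MultGlue.ptConst_mul hinv (isAlgebraic_gaussMultConst m (x + s))
      (hinv.mul (isAlgebraic_gaussMultConst m (x + s)))]
    exact MultGlue.ptConst_congr _ _ (cancelConst_eq m x s)
  rw [← e1, ← e2]
  linear_combination toFormalPeriod (of (IntegralRep.unit.constMul _ hinv)) * key

/-- **The shifted family from the crux instances modulo `BetaCancellation`, in `P`**: if Beta
classes can be cancelled and `At m z` holds for every rational `z > 0`, then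
`⟦[pt,1]⟧ ∏_(k<n) g(x + k/n, s) = ⟦[pt, n^(ns)]⟧ g(nx, ns) ∏_(1≤k<n) g(ks, s)` (`GM(m; x, s)` in `P`) for
all rational `x, s > 0`: both sides of `dirichletBlock_mul_gm_prod_eq` are classes of single Beta boxes,
and `BetaCancellation` cancels the block `D(x)` factor by factor (`cancel_prod_eq`).
[cite: AndrewsAskeyRoy1999, Thm 1.5.2] -/
theorem gm_prod_eq (hBC : BetaCancellation) {B : ℚ → ℚ → IntegralRep 1}
    (hB : ∀ p q, 0 < p → 0 < q → (B p q).domain = {t | t 0 ∈ Set.Ioo (0:ℝ) 1} ∧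
      (B p q).integrand = fun t => (t 0) ^ ((p:ℝ) - 1) * (1 - t 0) ^ ((q:ℝ) - 1))
    (m : ℕ) (hAt : ∀ z : ℚ, 0 < z → At m z) {x s : ℚ} (hx : 0 < x) (hs : 0 < s) :
    toFormalPeriod (of (IntegralRep.unit.constMul (1:ℝ) isAlgebraic_one)) *
        ∏ k : Fin (m + 1), toFormalPeriod (of (B (x + (k : ℚ) / ((m : ℚ) + 1)) s)) =
      toFormalPeriod (of (IntegralRep.unit.constMul (((m:ℝ) + 1) ^ (((m:ℝ) + 1) * (s:ℝ)))
        (MultGlue.isAlgebraic_gaussConst m s))) *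
        ∏ k : Fin (m + 1), toFormalPeriod (of (B
          (if (k : ℕ) = 0 then ((m : ℚ) + 1) * x else (k : ℚ) * s)
          (if (k : ℕ) = 0 then ((m : ℚ) + 1) * s else s))) := by
  -- the two sides are classes of single Beta boxes `ρ = [1; x + k/n, s]`, `ρ' = [n^(ns); α', β']`
  have hαpos : ∀ k : Fin (m + 1), 0 < x + (k : ℚ) / ((m : ℚ) + 1) := fun k => by positivity
  have hα'pos : ∀ k : Fin (m + 1), 0 < (if (k : ℕ) = 0 then ((m : ℚ) + 1) * x else (k : ℚ) * s) :=
    fun k => by split_ifs with h; exacts [by positivity, MultGlue.natCast_mul_pos h hs]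
  have hβ'pos : ∀ k : Fin (m + 1), 0 < (if (k : ℕ) = 0 then ((m : ℚ) + 1) * s else s) :=
    fun k => by split_ifs <;> positivity
  obtain ⟨ρ, hρd, hρi⟩ := MultGlue.exists_betaRep (N := m + 1) (1:ℝ) isAlgebraic_one
    (fun k => x + (k : ℚ) / ((m : ℚ) + 1)) (fun _ => s) hαpos (fun _ => hs)
  obtain ⟨ρ', hρ'd, hρ'i⟩ := MultGlue.exists_betaRep (N := m + 1) _
    (MultGlue.isAlgebraic_gaussConst m s)
    (fun k => if (k : ℕ) = 0 then ((m : ℚ) + 1) * x else (k : ℚ) * s)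
    (fun k => if (k : ℕ) = 0 then ((m : ℚ) + 1) * s else s) hα'pos hβ'pos
  have hρP := MultGlue.toFormalPeriod_box hB isAlgebraic_one hαpos (fun _ => hs) hρd hρi
  have hρ'P := MultGlue.toFormalPeriod_box hB (MultGlue.isAlgebraic_gaussConst m s) hα'pos hβ'pos
    hρ'd hρ'i
  have key : (∏ j ∈ range m, toFormalPeriod (of (B x (((j:ℚ) + 1) * x)))) * toFormalPeriod (of ρ) =
      (∏ j ∈ range m, toFormalPeriod (of (B x (((j:ℚ) + 1) * x)))) * toFormalPeriod (of ρ') := by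
    rw [hρP, hρ'P]
    exact dirichletBlock_mul_gm_prod_eq hB m hx hs (hAt x hx) (hAt (x + s) (by positivity))
  have hcancel := cancel_prod_eq hBC hB (fun _ => x) (fun j => ((j:ℚ) + 1) * x) m (fun _ _ => hx)
    (fun j _ => by positivity) ρ ρ' key
  rwa [hρP, hρ'P] at hcancel

end Cancellation

open Summit.KontsevichZagierPeriods.KontsevichZagierPeriods.Theses.TerasomaMultiplication (BetaCancellation)

/-- **The shifted family from the crux, modulo `BetaCancellation`.** If Beta classes can be
cancelled (crux 4 of the route) and the crux instance `At m z` holds for EVERY rational `z > 0`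
(`n = m + 1` fixed), then the shifted Gauss multiplication `GM(m; x, s)` holds inside the rules for
all rational `x, s > 0`: every box representation of `∏_(k<n) B(x + k/n, s)` is equivalent to every
box representation of `n^(ns) B(nx, ns) ∏_(j=1)^(n−1) B(js, s)` (`Cancellation.gm_prod_eq` read back
through `MultGlue.equiv_of_prod_eq` / `MultGlue.equivalent_of_equiv`). In words: modulo cancellation
the line's residual stubs (`GM` at the odd primes) ARE the crux at the odd primes.
[cite: AndrewsAskeyRoy1999, Thm 1.5.2] -/
theorem gm_of_betaCancellation_of_at (hBC : BetaCancellation) (m : ℕ)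
    (hAt : ∀ z : ℚ, 0 < z → At m z) :
    ∀ (x s : ℚ), 0 < x → 0 < s → ∀ (r r' : IntegralRep (m + 1)),
      r.domain = {z | ∀ i, z i ∈ Set.Ioo (0:ℝ) 1} →
      Set.EqOn r.integrand (fun z => ∏ k : Fin (m + 1),
        (z k) ^ ((x:ℝ) + ((k:ℕ):ℝ) / ((m:ℝ) + 1) - 1) * (1 - z k) ^ ((s:ℝ) - 1)) r.domain →
      r'.domain = {z | ∀ i, z i ∈ Set.Ioo (0:ℝ) 1} →
      Set.EqOn r'.integrand (fun z => ((m:ℝ) + 1) ^ (((m:ℝ) + 1) * (s:ℝ)) *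
        ((z 0) ^ (((m:ℝ) + 1) * (x:ℝ) - 1) * (1 - z 0) ^ (((m:ℝ) + 1) * (s:ℝ) - 1)) *
        ∏ j : Fin m, (z j.succ) ^ ((((j:ℕ):ℝ) + 1) * (s:ℝ) - 1) * (1 - z j.succ) ^ ((s:ℝ) - 1))
        r'.domain →
      Equivalent r r' := by
  intro x s hx hs r r' hr hri hr' hri'
  obtain ⟨B, hB⟩ := MultGlue.exists_betaFamily
  have hex := MultGlue.equiv_of_prod_eq hB isAlgebraic_one (MultGlue.isAlgebraic_gaussConst m s)
    (α := fun k : Fin (m + 1) => x + (k : ℚ) / ((m : ℚ) + 1)) (β := fun _ => s)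
    (α' := fun k : Fin (m + 1) => if (k : ℕ) = 0 then ((m : ℚ) + 1) * x else (k : ℚ) * s)
    (β' := fun k : Fin (m + 1) => if (k : ℕ) = 0 then ((m : ℚ) + 1) * s else s)
    (fun k => by positivity) (fun _ => hs)
    (fun k => by split_ifs with h; exacts [by positivity, MultGlue.natCast_mul_pos h hs])
    (fun k => by split_ifs <;> positivity)
    (Cancellation.gm_prod_eq hBC hB m hAt hx hs)
  exact MultGlue.equivalent_of_equiv hex r r' hr
    (fun z hz => (hri hz).trans (GlueFromParts.gmLeft_eq m x s z).symm) hr'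
    (fun z hz => (hri' hz).trans (GlueFromParts.gmRight_eq m x s z).symm)

/-- **The crux from its odd-prime instances, modulo `BetaCancellation`.** If Beta classes can be
cancelled and the crux holds at `m = p − 1` for every prime `p ≥ 5` and every rational `s > 0`, then
`MultiplicationAccessible` holds: the instances at `p = 3` are the landed `MultiplicationThree`
(`at_two`), the shifted family at every odd prime follows (`gm_of_betaCancellation_of_at`), and the
Sieve (`multiplicationAccessible_of_gm_odd_primes`) does the rest. [cite: AndrewsAskeyRoy1999, Thm 1.5.2] -/
theorem multiplicationAccessible_of_betaCancellation_of_primes :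
    Summit.KontsevichZagierPeriods.KontsevichZagierPeriods.Theses.TerasomaMultiplication.BetaCancellation →
    (∀ p : ℕ, p.Prime → 5 ≤ p → ∀ (s : ℚ), 0 < s → ∀ (r r' : KZ.IntegralRep (p - 1)),
      r.domain = {x | ∀ i, x i ∈ Set.Ioo (0:ℝ) 1} →
      Set.EqOn r.integrand (fun x => ∏ i : Fin (p - 1),
        (x i) ^ ((((i:ℕ):ℝ) + 1) / (((p - 1 : ℕ):ℝ) + 1) - 1) * (1 - x i) ^ ((s:ℝ) - 1)) r.domain →
      r'.domain = {x | (∀ i, 0 < x i) ∧ ∑ i, x i < ((p - 1 : ℕ):ℝ) + 1} →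
      Set.EqOn r'.integrand
        (fun x => ((∏ i, x i) * (((p - 1 : ℕ):ℝ) + 1 - ∑ i, x i)) ^ ((s:ℝ) - 1)) r'.domain →
      KZ.Equivalent r r') →
    Summit.KontsevichZagierPeriods.KontsevichZagierPeriods.Theses.TerasomaMultiplication.MultiplicationAccessible := by
  intro hBC h5
  refine multiplicationAccessible_of_gm_odd_primes fun p hp h3 => ?_
  by_cases hp3 : p = 3
  · subst hp3
    exact gm_of_betaCancellation_of_at hBC 2 fun z hz => at_two hz
  · have h5p : 5 ≤ p := by
      by_contra hlt
      push Not at hlt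
      interval_cases p
      · exact hp3 rfl
      · norm_num at hp
    exact gm_of_betaCancellation_of_at hBC (p - 1) fun z hz r r' hr hr' =>
      h5 p hp h5p z hz r r' hr.1 hr.2 hr'.1 hr'.2

end Summit.KontsevichZagierPeriods.TerasomaMultiplication.MultiplicationAccessible

end
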